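import Summits.PneNP.PneNP.Theorems.NegLimitedAmplifiedWindowAmpHybrid
import Summits.PneNP.PneNP.Theorems.NegLimitedAmplifiedWindowAmpBiasDecay
import Mathlib
import HarnessLib

/-!
# Amplified critical window — stub A, part A8 `ProjectionCorner` (gate-free circuits)
(cell pnp-ideate, rung F-N1/p3, ROUND-12; line `amplified-window` on item stmt-PneNP-19860, stub A
`MonotoneAmplification`; typed part `Amp.ProjectionCorner` of `NegLimitedAmplifiedWindowAmpDefs.lean`,
blueprint HOME/pnp-ideate-p3/r12/BLUEPRINT-A.md §8)

`projectionCorner_holds : ProjectionCorner` — a circuit with no gates outputs an input variable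
`x_{(w₀,i₀)}` (`eval_eq_of_size_zero`); under the block-product weight with `f` balanced, its agreement
with `RM3_d ⊗ f` is at most `½ + 2^{-(d+1)}`.  Proof by the machinery of the other parts: the hybrid step
(`Amp.hybridStep`) with `η = 0` on all blocks `≠ w₀` (a projection onto block `w₀` ignores the other blocks,
so its one-block agreement is exactly `½`), the coin bound (`finalHybridBound_holds`), and the single-leaf
bias of `RM3_d`: `|bias(RM3_d | one leaf fixed, others uniform)| = 2^{-d}` (`abs_rbias_oneLeaf`, from the
recursive bias `rbias` of `NegLimitedAmplifiedWindowBiasMoments.lean` via `cbias_eq_rhoBias`/`rhoBias_eq_rbias`).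

References: R. O'Donnell, *Hardness amplification within NP*, JCSS 69 (2004), §4 [ODonnell2004].

HONEST FRAMING: a sub-lemma of the OPEN stub A; nothing here bears on P vs NP.
-/

set_option linter.dupNamespace false -- `Summit.PneNP.PneNP.…`: summit = sub-problem name (D-0017 single-conjunct layout)

namespace Summit.PneNP.PneNP.Theorems.NegLimitedAmplifiedWindow.Amp

open Finset Function
open Literature.Computability.Complexity
open Summit.PneNP.PneNP.Theorems.NegLimitedDoor (massAt agreeAt massAt_false_add_massAt_true)
open Summit.PneNP.PneNP.Theorems.NegLimitedAmplifiedWindow (Restr rbias recMaj3 recMaj3_monotone)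

/-! ### Gate-free circuits are projections -/

/-- A circuit with no gates outputs one of its input variables. -/
theorem eval_eq_of_size_zero {κ : Type} (M : Circuit κ) (hM : M.size = 0) : ∃ q : κ, ∀ x, M.eval x = x q := by
  have hlen : M.gates.length = 0 := hM
  rcases hq : M.output with q | m
  · refine ⟨q, fun x => ?_⟩
    unfold Circuit.eval
    rw [hq]
  · exact absurd (M.wf_output m hq) (by omega)

/-! ### The single-leaf bias of `RM3_d` -/

/-- The restriction with one fixed leaf `w₀ ↦ b`, all others free. -/
def oneLeaf {d : ℕ} (w₀ : Fin d → Fin 3) (b : Bool) : Restr d := fun w => if w = w₀ then some b else none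

/-- The all-free restriction has bias `0`. -/
theorem rbias_allFree : ∀ d : ℕ, rbias d (fun _ => none) = 0
  | 0 => by simp [rbias]
  | d + 1 => by
    have h : rbias d (fun _ => none) = 0 := rbias_allFree d
    show (rbias d (fun _ => none) + rbias d (fun _ => none) + rbias d (fun _ => none) -
      rbias d (fun _ => none) * rbias d (fun _ => none) * rbias d (fun _ => none)) / 2 = 0
    rw [h]
    norm_num

/-- **Single-leaf bias**: `|bias(RM3_d | leaf w₀ := b)| = 2^{-d}`. -/
theorem abs_rbias_oneLeaf : ∀ (d : ℕ) (w₀ : Fin d → Fin 3) (b : Bool), |rbias d (oneLeaf w₀ b)| = (1 / 2) ^ d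
  | 0, w₀, b => by
    have h : oneLeaf w₀ b = fun _ => some b := funext fun w => by
      simp [oneLeaf, Subsingleton.elim w w₀]
    rw [h]
    cases b <;> simp [rbias]
  | d + 1, w₀, b => by
    -- the subtree containing the leaf carries `oneLeaf (tail w₀) b`, the other two are free
    have hsub : ∀ i : Fin 3, (fun w => oneLeaf w₀ b (Fin.cons i w)) =
        if i = w₀ 0 then oneLeaf (Fin.tail w₀) b else fun _ => none := by
      intro i
      funext w
      by_cases hi : i = w₀ 0
      · simp only [hi, if_true, oneLeaf]
        have : (Fin.cons (w₀ 0) w = w₀) ↔ (w = Fin.tail w₀) := by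
          constructor
          · intro h; rw [← h, Fin.tail_cons]
          · intro h; rw [h, Fin.cons_self_tail]
        simp only [this]
      · simp only [hi, if_false, oneLeaf]
        have : Fin.cons i w ≠ w₀ := fun h => hi (by rw [← h, Fin.cons_zero])
        simp [this]
    rw [rbias, hsub 0, hsub 1, hsub 2]
    have ih := abs_rbias_oneLeaf d (Fin.tail w₀) b
    have hfin : ∀ r : ℝ, |r| = (1 / 2) ^ d → |r / 2| = (1 / 2) ^ (d + 1) := fun r hr => by
      rw [abs_div, hr, abs_two, pow_succ]; ring
    -- exactly one of the three indices is `w₀ 0`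
    have h3 : ∀ j : Fin 3, j = 0 ∨ j = 1 ∨ j = 2 := by decide
    rcases h3 (w₀ 0) with h | h | h
    · rw [h, if_pos (show (0 : Fin 3) = 0 from rfl), if_neg (show ¬((1 : Fin 3) = 0) by decide),
        if_neg (show ¬((2 : Fin 3) = 0) by decide), rbias_allFree]
      simp only [add_zero, mul_zero, sub_zero]
      exact hfin _ ih
    · rw [h, if_neg (show ¬((0 : Fin 3) = 1) by decide), if_pos (show (1 : Fin 3) = 1 from rfl),
        if_neg (show ¬((2 : Fin 3) = 1) by decide), rbias_allFree]
      simp only [zero_add, add_zero, mul_zero, zero_mul, sub_zero]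
      exact hfin _ ih
    · rw [h, if_neg (show ¬((0 : Fin 3) = 2) by decide), if_neg (show ¬((1 : Fin 3) = 2) by decide),
        if_pos (show (2 : Fin 3) = 2 from rfl), rbias_allFree]
      simp only [zero_add, mul_zero, zero_mul, sub_zero]
      exact hfin _ ih

/-- The free set "all but `w₀`" with values `v` is the one-leaf restriction. -/
theorem toRestr_erase {d : ℕ} (w₀ : Fin d → Fin 3) (v : (Fin d → Fin 3) → Bool) :
    toRestr (univ.erase w₀) v = oneLeaf w₀ (v w₀) := by
  funext w
  by_cases h : w = w₀
  · subst h; simp [toRestr, oneLeaf]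
  · simp [toRestr, oneLeaf, h]

/-- **Single-leaf bias in p3's vocabulary**: `|cbias RM3_d (univ ∖ {w₀}) v| = 2^{-d}`. -/
theorem abs_cbias_erase {d : ℕ} (w₀ : Fin d → Fin 3) (v : (Fin d → Fin 3) → Bool) :
    |cbias (recMaj3 d) (univ.erase w₀) v| = (1 / 2) ^ d := by
  rw [cbias_eq_rhoBias, rhoBias_eq_rbias, toRestr_erase, abs_rbias_oneLeaf]

/-! ### A8 -/

/-- **A8 `ProjectionCorner`**, BY NAME. -/
theorem projectionCorner_holds : ProjectionCorner := by
  intro ι _ _ D f d M hD hD1 hbal hM0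
  classical
  obtain ⟨⟨w₀, i₀⟩, hq⟩ := eval_eq_of_size_zero M hM0
  have hbal' : massAt D f false = 1 / 2 := by
    have := massAt_false_add_massAt_true D f; rw [hbal, hD1] at this; linarith
  have hmass : ∀ b, massAt D f b = 1 / 2 := fun b => by cases b <;> assumption
  -- curry
  rw [curryBridge_holds ι d D f M.eval]
  simp only [hq]
  -- hybrid step with `η = 0` on all blocks but `w₀`
  set S : Finset (Fin d → Fin 3) := univ.erase w₀ with hS
  have hstep := hybridStep (fun _ : Fin d → Fin 3 => D) f (recMaj3_monotone d)
    (fun X : (Fin d → Fin 3) → ι → Bool => X w₀ i₀) S le_rfl (fun _ a => hD a) (fun w hw X => by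
      have hne : w ≠ w₀ := Finset.ne_of_mem_erase hw
      simp only [update_of_ne hne.symm, add_zero]
      have : (∑ a, if X w₀ i₀ = f a then D a else 0) = massAt D f (X w₀ i₀) := by
        unfold massAt; exact Finset.sum_congr rfl fun a _ => by simp only [eq_comm]
      rw [this, hmass, hD1]; norm_num)
  simp only [zero_mul, add_zero] at hstep
  refine hstep.trans ?_
  -- coins: `½ + ½·2^{-d}`
  have hcoin := finalHybridBound_holds (Fin d → Fin 3) (ι → Bool) (fun _ => D) f (recMaj3 d)
    (fun X : (Fin d → Fin 3) → ι → Bool => X w₀ i₀) S (fun _ a => hD a)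
  refine hcoin.trans ?_
  simp only [hD1, Finset.prod_const_one, mul_one, hS, abs_cbias_erase]
  rw [← Finset.sum_mul, sum_bw_eq_prod]
  simp only [hD1, Finset.prod_const_one, one_mul, pow_succ]
  linarith

end Summit.PneNP.PneNP.Theorems.NegLimitedAmplifiedWindow.Amp
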